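import Summits.Langlands.Langlands.Theses.HeckeFieldDeRham

/-!
# Census sketch (r1, redirect strategist) — crux `AlgebraicTraceRigidity` (stmt-Langlands-17408)

Typed signatures for the r1 STRATEGY-CENSUS (second opinion).  NOT a registered line.
New relative to b1's `CensusSketch.lean`: the INTEGRALITY / ARCHIMEDEAN "companion-shadow"
split `TraceIntegrality → TraceArchBound → ATR_IntArch → AlgebraicTraceRigidity`
(recomposition proved), which isolates exactly the two inputs that the arithmetic-holonomy
engine (Calegari–Dimitrov–Tang 2021–25) needs and that a bare `E`-rational `ρ` lacks, and the
automorphic-shadow form `ATR_AutIntArch` consumed by the route's `closes`.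
-/

set_option linter.dupNamespace false
set_option linter.unusedVariables false

namespace Summit.Langlands.Langlands.Cruxes.AlgebraicTraceRigidity.CensusR1

open Literature.NumberTheory.GaloisRepresentations Literature.NumberTheory.PAdicHodge
open Summit.Langlands.Langlands.Theses.HeckeFieldDeRham (AlgebraicTraceRigidity)

section Defs

variable (F : Type) [Field F] [NumberField F] (n : ℕ)

/-- The three hypotheses of ATR on one `ℓ`-adic `ρ`. -/
def Hyp (ℓ : ℕ) [Fact ℓ.Prime] (ρ : FramedGaloisRep F (PadicAlgCl ℓ) n) : Prop :=
  ρ.toGaloisRep.IsIrreducible ∧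
  (∀ᶠ v : IsDedekindDomain.HeightOneSpectrum (NumberField.RingOfIntegers F) in Filter.cofinite,
      ρ.IsUnramifiedAt v) ∧
  (∃ E : Subfield (PadicAlgCl ℓ), FiniteDimensional ℚ E ∧
    ∀ᶠ v : IsDedekindDomain.HeightOneSpectrum (NumberField.RingOfIntegers F) in Filter.cofinite,
      ∃ P : Polynomial (PadicAlgCl ℓ), (∀ i : ℕ, P.coeff i ∈ E) ∧ ρ.HasFrobCharpolyAt v P)

/-- The conclusion of ATR on one `ℓ`-adic `ρ`: de Rham for the pinned datum at every `v ∣ ℓ`. -/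
def Concl (ℓ : ℕ) [Fact ℓ.Prime] (ρ : FramedGaloisRep F (PadicAlgCl ℓ) n) : Prop :=
  ∀ (v : IsDedekindDomain.HeightOneSpectrum (NumberField.RingOfIntegers F))
    (hv : ((ℓ : ℕ) : NumberField.RingOfIntegers F) ∈ v.asIdeal),
    (fontainePstAdicCompletion v ℓ hv).IsDeRhamFramed (ρ.toLocal v)

/-- INTEGRALITY SHADOW (what an automorphic or motivic origin would give and `E`-rationality does
not): after scaling by a fixed power of the residue cardinality, the Frobenius characteristic
polynomials have algebraic-INTEGER coefficients (integral at every finite place of `ℚ̄`, not only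
at the place `λ₀` induced by `E ⊂ ℚ̄_ℓ`, where integrality is automatic by compactness). -/
def IntegralTraces (ℓ : ℕ) [Fact ℓ.Prime] (ρ : FramedGaloisRep F (PadicAlgCl ℓ) n) : Prop :=
  ∃ N : ℕ, ∀ᶠ v : IsDedekindDomain.HeightOneSpectrum (NumberField.RingOfIntegers F) in Filter.cofinite,
    ∃ P : Polynomial (PadicAlgCl ℓ), ρ.HasFrobCharpolyAt v P ∧
      ∀ i : ℕ, IsIntegral ℤ (((Nat.card (NumberField.RingOfIntegers F ⧸ v.asIdeal) : ℕ) :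
        PadicAlgCl ℓ) ^ N * P.coeff i)

/-- ARCHIMEDEAN SHADOW (purity-type growth, free for cuspidal `π` by Jacquet–Shalika, absent for a
bare `ρ`): under every field isomorphism `ι : ℚ̄_ℓ ≃ ℂ` the Frobenius coefficients grow at most
polynomially in the residue cardinality. -/
def ArchBounded (ℓ : ℕ) [Fact ℓ.Prime] (ρ : FramedGaloisRep F (PadicAlgCl ℓ) n) : Prop :=
  ∀ ι : PadicAlgCl ℓ ≃+* ℂ, ∃ C A : ℝ,
    ∀ᶠ v : IsDedekindDomain.HeightOneSpectrum (NumberField.RingOfIntegers F) in Filter.cofinite,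
      ∃ P : Polynomial (PadicAlgCl ℓ), ρ.HasFrobCharpolyAt v P ∧
        ∀ i : ℕ, ‖ι (P.coeff i)‖ ≤
          C * ((Nat.card (NumberField.RingOfIntegers F ⧸ v.asIdeal) : ℕ) : ℝ) ^ A

end Defs

/-- ATR unfolded as `Hyp → Concl`. -/
theorem atr_iff : AlgebraicTraceRigidity ↔
    ∀ (F : Type) [Field F] [NumberField F] (n ℓ : ℕ) [Fact ℓ.Prime]
      (ρ : FramedGaloisRep F (PadicAlgCl ℓ) n), Hyp F n ℓ ρ → Concl F n ℓ ρ := by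
  constructor
  · intro h F _ _ n ℓ _ ρ hyp
    exact h F n ℓ ρ hyp.1 hyp.2.1 hyp.2.2
  · intro h F _ _ n ℓ _ ρ h1 h2 h3
    exact h F n ℓ ρ ⟨h1, h2, h3⟩

/-! ## The companion-shadow split (Decomposition heading of the r1 census)

`ATR_IntArch` is ATR with the two extra hypotheses the Calegari–Dimitrov–Tang arithmetic holonomy
bounds consume (denominator type and an archimedean template); `TraceIntegrality` and
`TraceArchBound` say that `E`-rationality alone already forces them.  All three are CONSEQUENCES of
"ATR + Fontaine–Mazur + Langlands" and none is known; the recomposition is pure logic. -/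

/-- Piece 1: ATR under the integrality and archimedean shadows. -/
def ATR_IntArch : Prop :=
  ∀ (F : Type) [Field F] [NumberField F] (n ℓ : ℕ) [Fact ℓ.Prime]
    (ρ : FramedGaloisRep F (PadicAlgCl ℓ) n),
    Hyp F n ℓ ρ → IntegralTraces F n ℓ ρ → ArchBounded F n ℓ ρ → Concl F n ℓ ρ

/-- Piece 2: `E`-rational irreducible a.e.-unramified `ρ` have integral Frobenius polynomials. -/
def TraceIntegrality : Prop :=
  ∀ (F : Type) [Field F] [NumberField F] (n ℓ : ℕ) [Fact ℓ.Prime]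
    (ρ : FramedGaloisRep F (PadicAlgCl ℓ) n), Hyp F n ℓ ρ → IntegralTraces F n ℓ ρ

/-- Piece 3: `E`-rational irreducible a.e.-unramified `ρ` have archimedean-polynomial traces. -/
def TraceArchBound : Prop :=
  ∀ (F : Type) [Field F] [NumberField F] (n ℓ : ℕ) [Fact ℓ.Prime]
    (ρ : FramedGaloisRep F (PadicAlgCl ℓ) n), Hyp F n ℓ ρ → ArchBounded F n ℓ ρ

/-- Recomposition (proved): the three pieces give the crux BY NAME. -/
theorem atr_of_shadow_split (h₁ : TraceIntegrality) (h₂ : TraceArchBound) (h₃ : ATR_IntArch) :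
    AlgebraicTraceRigidity := by
  rw [atr_iff]
  intro F _ _ n ℓ _ ρ hyp
  exact h₃ F n ℓ ρ hyp (h₁ F n ℓ ρ hyp) (h₂ F n ℓ ρ hyp)

/-- Piece 1 is implied by the crux (so the split is a consequence-split in its first piece;
pieces 2 and 3 are logically independent of ATR as typed). -/
theorem intArch_of_atr (h : AlgebraicTraceRigidity) : ATR_IntArch := by
  rw [atr_iff] at h
  intro F _ _ n ℓ _ ρ hyp _ _
  exact h F n ℓ ρ hyp

/-! ## What `closes` actually consumes, with the shadows a cuspidal `π` supplies

`ATR_AutIntArch`: de Rham above `ℓ` for an irreducible `ρ` that is `E`-rational, trace-integral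
and archimedean-bounded — the three properties an `L`-algebraic cuspidal `π` with `L`-arithmetic,
`L`-integral Satake parameters hands to its avatar (Jacquet–Shalika for the third).  It is weaker
than `ATR_IntArch` only by name; recorded to make the re-target explicit. -/

/-- The re-target candidate: ATR for representations carrying all three automorphic shadows. -/
def ATR_AutShadow : Prop := ATR_IntArch

theorem autShadow_of_atr (h : AlgebraicTraceRigidity) : ATR_AutShadow := intArch_of_atr h

end Summit.Langlands.Langlands.Cruxes.AlgebraicTraceRigidity.CensusR1
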